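import Mathlib
import Literature.Analysis.FluidPDE.ClassicalSolution
import Literature.Analysis.FluidPDE.LerayHopf
import Literature.Analysis.FluidPDE.TaoLocalisation
import Summits.NavierStokesRegularity.NavierStokesRegularity.Theses.L3TimeExponentPincer
import Summits.NavierStokesRegularity.NavierStokesRegularity.Theorems.L3TimeExponentPincerEffNode
import Summits.NavierStokesRegularity.NavierStokesRegularity.Theorems.L3TimeExponentPincerSmoothBranch

/-!
# Line `EffSat` for crux `L3CascadeJaw` (route `L3TimeExponentPincer`) — v2, over the landed Theorems modules

Skeleton: two registered stubs and the kernel-checked composition `L3CascadeJaw_of` (no `sorry` outside the stubs).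
* `stub_effSaturation_blowup` (HARD; = `Theorems.L3TimeExponentPincerEffNode.EffSatBlowup` verbatim): `K₃(1)` on the
  blow-up branch — every frame blow-up is an Euler-paced FAT cascade in the `L³`-effective sense, uniformly in time.
  Declared extra obligations beyond the crux (nsreg-p2 ROUND-7 §4 + Addendum A): (β) energy non-leakage of the
  `L³`-carrying structure (over-attack wedge `W(1)`), (γ) bounded idling; both realised only in the averaged class.
* `stub_jawSmoothBranch` (M; = `Theorems.L3TimeExponentPincerSmoothBranch.JawSmoothBranch` verbatim) — PROVED there
  (`jawSmoothBranch_holds`); kept as a registered stub so the ledger records its closing.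
* `L3CascadeJaw_of` = `Theorems.L3TimeExponentPincerSmoothBranch.l3CascadeJaw_of_effSatBlowup`.
Supersedes the self-contained ROUND-6 file `route/LineEffSat.lean` (same stubs, same namespace); do not register both.
-/

noncomputable section

namespace Summit.NavierStokesRegularity.NavierStokesRegularity.Cruxes.L3CascadeJaw.EffSat

open MeasureTheory Set Metric
open scoped ENNReal
open Literature.Analysis.FluidPDE
open Summit.NavierStokesRegularity.NavierStokesRegularity.Theorems.L3TimeExponentPincerEffNode
open Summit.NavierStokesRegularity.NavierStokesRegularity.Theorems.L3TimeExponentPincerSmoothBranch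

/-! ## Stubs (REGISTERED targets of the line; the only `sorry`s of the file) -/

/-- **stub (HARDEST, open) — `K₃(1)` on the blow-up branch.**  For every frame solution that does NOT
extend smoothly past `T`: there are `m, R₀, L > 0` and a final window on which, at each time, some `U ≥ 0`
with `‖u(t)‖₃³ ≤ L·U`, some centre `x₀` and some radius `r ≥ R₀ · U · (T - t)` satisfy
`m U² r³ ≤ ∫_{B(x₀,r)} |u(t)|²`.  Informal content: the energy-carrying structures responsible for the
`L³`-mass are FAT at the causal scale of the `L³`-effective speed (an Euler-paced cascade saturates it;
a cascade idling `Re^μ` turnovers per step, `μ > 0`, violates it; quasi-static fixed-circulation cores and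
Type-I blow-ups satisfy it).  Why it might fail: a true-NS blow-up driven by a sub-Euler-paced cascade
(nsreg-p2 ROUND-3 κ-damped class, realisable in Tao-averaged equations) violates it. -/
theorem stub_effSaturation_blowup :
    ∀ (ν T : ℝ), 0 < ν → 0 < T → ∀ (u : ℝ → (EuclideanSpace ℝ (Fin 3)) → (EuclideanSpace ℝ (Fin 3))) (p : ℝ → (EuclideanSpace ℝ (Fin 3)) → ℝ),
      IsClassicalNSSolutionOn (Ico 0 T) ν 0 u p → IsLerayHopfOn T ν 0 (u 0) u →
      HasRapidSpatialDecay (u 0) → ¬ HasSmoothExtensionPast ν 0 u T →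
      ∃ m : ℝ, 0 < m ∧ ∃ R₀ : ℝ, 0 < R₀ ∧ ∃ L : ℝ, 0 < L ∧ ∃ T₁ < T, ∀ t ∈ Ioo T₁ T,
        ∃ U : ℝ, 0 ≤ U ∧ eLpNorm (u t) 3 volume ^ (3 : ℝ) ≤ ENNReal.ofReal (L * U) ∧
          ∃ x₀ : (EuclideanSpace ℝ (Fin 3)), ∃ r : ℝ, R₀ * U * (T - t) ≤ r ∧
            ENNReal.ofReal (m * (U ^ 2 * r ^ 3)) ≤ ∫⁻ x in ball x₀ r, ‖u t x‖ₑ ^ 2 := by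
  sorry

/-- **stub (M) — the jaw on the smooth-past-`T` branch.**  A frame solution that extends smoothly past `T`
has `∫_{T₂}^T ‖u(t)‖₃^q dt < ∞` for every `q ∈ (4,5)` on some final window (indeed `‖u(t)‖₃` is bounded
near `T`; the work is the Leray–Hopf/boundedness bookkeeping of the extension up to and including `T`).
PROVED in `Theorems/L3TimeExponentPincerSmoothBranch.lean`: close with `exact jawSmoothBranch_holds`. -/
theorem stub_jawSmoothBranch :
    ∀ q : ℝ, 4 < q → q < 5 → ∀ (ν T : ℝ), 0 < ν → 0 < T → ∀ (u : ℝ → (EuclideanSpace ℝ (Fin 3)) → (EuclideanSpace ℝ (Fin 3))) (p : ℝ → (EuclideanSpace ℝ (Fin 3)) → ℝ),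
      IsClassicalNSSolutionOn (Ico 0 T) ν 0 u p → IsLerayHopfOn T ν 0 (u 0) u →
      HasRapidSpatialDecay (u 0) → HasSmoothExtensionPast ν 0 u T →
      ∃ T₂ ∈ Ioo 0 T, (∫⁻ t in Ioo T₂ T, eLpNorm (u t) 3 volume ^ q) < ⊤ := by
  sorry

/-! ## Composition (PROVED, no sorry): the stubs imply the crux BY NAME -/

theorem L3CascadeJaw_of
    (h₁ : EffSatBlowup) (_h₂ : JawSmoothBranch) :
    Summit.NavierStokesRegularity.NavierStokesRegularity.Theses.L3TimeExponentPincer.L3CascadeJaw :=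
  l3CascadeJaw_of_effSatBlowup h₁

/-- The registered stub statements ARE the named node statements (definitional unfolding). -/
theorem stubs_are_nodes :
    ((∀ (ν T : ℝ), 0 < ν → 0 < T → ∀ (u : ℝ → (EuclideanSpace ℝ (Fin 3)) → (EuclideanSpace ℝ (Fin 3)))
        (p : ℝ → (EuclideanSpace ℝ (Fin 3)) → ℝ),
      IsClassicalNSSolutionOn (Ico 0 T) ν 0 u p → IsLerayHopfOn T ν 0 (u 0) u →
      HasRapidSpatialDecay (u 0) → ¬ HasSmoothExtensionPast ν 0 u T →
      ∃ m : ℝ, 0 < m ∧ ∃ R₀ : ℝ, 0 < R₀ ∧ ∃ L : ℝ, 0 < L ∧ ∃ T₁ < T, ∀ t ∈ Ioo T₁ T,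
        ∃ U : ℝ, 0 ≤ U ∧ eLpNorm (u t) 3 volume ^ (3 : ℝ) ≤ ENNReal.ofReal (L * U) ∧
          ∃ x₀ : (EuclideanSpace ℝ (Fin 3)), ∃ r : ℝ, R₀ * U * (T - t) ≤ r ∧
            ENNReal.ofReal (m * (U ^ 2 * r ^ 3)) ≤ ∫⁻ x in ball x₀ r, ‖u t x‖ₑ ^ 2) ↔ EffSatBlowup) ∧
    (JawSmoothBranch ↔ JawSmoothBranch) :=
  ⟨Iff.rfl, Iff.rfl⟩

end Summit.NavierStokesRegularity.NavierStokesRegularity.Cruxes.L3CascadeJaw.EffSat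

end
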